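import Summits.QuantumFields.YangMills.Theorems.UnitScaleTiltProp7AxialLemma1
import HarnessLib

/-!
# Route `UnitScaleTilt`, crux K1 child «MinimiserStabilityRegPr» (stmt-QuantumFields-19200), registered stub `stub_prop7From14` (skeleton birth_v7
# cc37a178…; leaf V3 «Prop 7 from a background (14)») — THE CELLS OF `k`-FOLD CENTRES ON THE TORUS AND THE COCYCLE OF COMB GAUGES:
# the `2ᵈ` centres surrounding a site, their combs (no wrap-around, lengths `≤ d·L^k`, net displacements), the transport law of the comb element along
# a bond (error `|Γ|·(δ_W + δ₀)`), and — at the d = 3 carrier — two comb elements of one regular (0.4)-fibre from ADJACENT centres are `113(ε₀ + e₀)`-close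

Cell `ym3-torus` ∕ fleet seat `ym-ust-19200-p1` (gen 9; HUMAN RULING D-0037, YM ladder rung R3).  WHY.  Brick 3 of the blended-comb-gauge line
(CARD-19200-V3-g9.md): the (4)-element of the line at a site `z` is the trilinear blend (`Prop7GeodesicBlend`) of the eight comb elements
`v_y(z) = U₀(Γ_{y,z})⁻¹·W(Γ_{y,z})` ([Balaban1985Variational] (18); gen 7 `Prop7AxialGauge`) of the centres `y` of the CELL of `z` — the `2³` `k`-fold centres
`embIter k (c(z) + ε)`, `ε ∈ {0,1}³`, between which `z` lies (read off the translate `z − off`, `off` = the uniform centre offset of gen 7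
`Prop7AxialGaugeFace.exists_off_embIter`).  Besides the torus geometry of these cells the file supplies the two analytic inputs of the blend estimate:
(E1) along a bond `b = ⟨z, μ⟩` the comb element of ANY centre `y` is transported by `v_y(z + e_μ) = U₀,b⁻¹·r⁻¹·v_y(z)·W_b`, `dist1(r) ≤ |z − y|₁·(δ_W + δ₀)`
(gen 7 `Prop7AxialGaugeSup.dist1_mul_inv_le_of_axial` = [Balaban1985RegularSpaces] Lemma 1's interior mechanism, for combs reaching into neighbouring blocks);
(E2) for `W, U₀` regular with the SAME `(K−n)`-fold (0.4)-average, comb elements from adjacent centres differ by `dist1(v_y(z)·v_{y′}(z)⁻¹) ≤ 112.25·(e_W + e₀)`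
(the ★19200-p2 contour comparison `IterPlaqSmall.dist1_contour_iter_le_T3` on `Γ_{y,z} ∪ (−Γ_{y′,z})`, as in gen 7's face bound).

WHAT IS PROVED (sorry-free, no definition).  §1 Cells: `transl_neg_shift`, `transl_shift_eq`, **`rel_corner_eq`** (`rel (embIter k (c + ε)) z ν =
r_ν − ε_ν·L^k`, `r_ν = (z − off)_ν mod L^k`, `c = iterBlockOf k (z − off)`; no wrap-around, needs `≥ 3` blocks per direction), `natAbs_rel_corner_le` ∕
`l1_rel_corner_le` ∕ `noWrap_corner`, `cell_shift_of_lt` (interior step: same cell, `r_μ ↦ r_μ + 1`), `cell_shift_of_eq` (face step: shifted cell,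
`r_μ ↦ 0`), `cell_centre` (a centre is the corner `ε = 0` of its own cell with `r = 0`).  §2 Words `Γ_{y,z} ∪ (−Γ_{y′,z})`: `netDisp_cornerWord`,
`walkEnd_cornerWord`, `length_cornerWord`, `axialT_mul_inv_eq_holAt`.  §3 (E1) `axialT_combElem`, **`dist1_combElem_transport_le`**.  §4 (E2) at the
carrier: `dist1_iter_mul_inv_cornerWord_le_T3`, **`dist1_combElem_mul_inv_le_T3`**.

HONEST SCOPE.  Lattice bookkeeping plus two direct applications of landed estimates; count-neutral helper toward stmt-QuantumFields-19200 (`--supports`).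

References: T. Bałaban, CMP 102 (1985) 277–309 [Balaban1985Variational] ((4), (18), (145)/(151)); CMP 99 (1985) 75–102 [Balaban1985RegularSpaces]
(Lemma 1 p.79); CMP 95 (1984) 17–40 [Balaban1984PropagatorsI] ((1.6)–(1.7) p.18); CMP 109 (1987) 249–301 [Balaban1987RG1] ((0.1), (0.4) pp.251–253).
-/

noncomputable section

namespace Summit.QuantumFields.YangMills.Theorems.Prop7BlendCells

open scoped Matrix.Norms.L2Operator
open Literature.MathematicalPhysics.QuantumFieldTheory.Balaban1983to89
open T4Continuum T4ReflectionCone BlockAveraging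
open B10Eq27TorusAxialLog (axialT rel rel_apply holT holT_eq_holAt transl transl_apply gaugeActT gaugeActT_apply gaugeActT_eq_gaugeAct axialT_self)
open B7Prop1Explicit (treeWord l1)
open B7Prop1Explicit renaming Site → LSite
open B5Eq118OneStroke (iterBlockOf val_iterBlockOf)
open B15DeterminingSets (embIter)
open Summit.QuantumFields.YangMills.Theorems.Prop7FlatHolonomy (sitesPerDir_zero_eq_mul_pow)
open Summit.QuantumFields.YangMills.Theorems.Prop7AxialGaugeFace (netDisp_treeWord walkEnd_treeWord_rel iterBlockOf_shift_of_face val_shift_mod_of_face)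
open Summit.QuantumFields.YangMills.Theorems.Prop7AxialLemma1 (iterBlockOf_shift_of_not_face)
open Summit.QuantumFields.YangMills.Theorems.Prop7AxialGauge (axialT_gaugeActT)
open Summit.QuantumFields.YangMills.Theorems.Prop7AxialGaugeSup (dist1_mul_inv_le_of_axial holAt_walk_append_wordRev)

/-! ## §1 The cells of `k`-fold centres -/

section Cells

variable {P : Params} {k : ℕ}

/-- Translation by a constant vector commutes with the unit shift. [cite: Balaban1987RG1, (0.1) p.251] -/
theorem transl_neg_shift (z : Site P 0) (v : LSite P.d) (μ : Fin P.d) : transl (z.shift μ) v = (transl z v).shift μ := by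
  funext ν
  simp only [transl_apply, Site.shift]
  by_cases hν : ν = μ
  · subst hν; simp only [Function.update_self]; ring
  · simp only [Function.update_of_ne hν, transl_apply]

/-- `(c + ε) + e_ν = c + (ε + e_ν)` on the coarse torus. [cite: Balaban1987RG1, (0.1) p.251] -/
theorem transl_shift_eq (c : Site P k) (ε : LSite P.d) (ν : Fin P.d) :
    (transl c ε).shift ν = transl c (fun κ => ε κ + if κ = ν then 1 else 0) := by
  funext κ
  simp only [transl_apply, Site.shift]
  by_cases hκ : κ = ν
  · subst hκ; simp only [Function.update_self, if_true]; push_cast; ring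
  · simp only [Function.update_of_ne hκ, hκ, if_false, add_zero, transl_apply]

/-- **THE RELATIVE POSITION OF A SITE FROM THE CORNERS OF ITS CELL** (no wrap-around; at least three `k`-blocks per direction): with `off` the uniform
centre offset, `z′ = z − off`, `c = iterBlockOf k z′` and `r_ν = z′_ν mod L^k`, the corner centre `embIter k (c + ε)`, `ε ∈ {0,1}ᵈ`, sees `z` at relative
position `r_ν − ε_ν·L^k` in direction `ν`. [cite: Balaban1984PropagatorsI, (1.6)-(1.7) p.18; Balaban1987RG1, (0.1) p.252] -/
theorem rel_corner_eq (hk : k ≤ P.m + P.K) (hN : 3 ≤ P.sitesPerDir k) {off : ℕ}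
    (hoff : ∀ (y : Site P k) (μ : Fin P.d), ((embIter k y) μ).val = (y μ).val * P.L ^ k + off)
    (z : Site P 0) (ε : LSite P.d) (hε : ∀ ν, ε ν = 0 ∨ ε ν = 1) (ν : Fin P.d) :
    rel (embIter k (transl (iterBlockOf k (transl z (fun _ => -(off : ℤ)))) ε)) z ν =
      ((((transl z (fun _ => -(off : ℤ))) ν).val % P.L ^ k : ℕ) : ℤ) - ε ν * ((P.L ^ k : ℕ) : ℤ) := by
  set h := P.L ^ k with hh
  have hNN : P.sitesPerDir 0 = P.sitesPerDir k * h := sitesPerDir_zero_eq_mul_pow hk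
  have hpos : 0 < h := pow_pos P.L_pos k
  set z' : Site P 0 := transl z (fun _ => -(off : ℤ)) with hz'
  set c : Site P k := iterBlockOf k z' with hc
  have hdm : (z' ν).val = h * (c ν).val + (z' ν).val % h := by
    rw [hc, val_iterBlockOf k hk z' ν]; exact (Nat.div_add_mod _ _).symm
  have hrlt : (z' ν).val % h < h := Nat.mod_lt _ hpos
  generalize hr : (z' ν).val % h = r at hdm hrlt
  have hclt : (c ν).val < P.sitesPerDir k := ZMod.val_lt _
  obtain ⟨e, he01, heε⟩ : ∃ e : ℕ, (e = 0 ∨ e = 1) ∧ ε ν = (e : ℤ) := by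
    rcases hε ν with h0 | h1
    · exact ⟨0, Or.inl rfl, by rw [h0]; rfl⟩
    · exact ⟨1, Or.inr rfl, by rw [h1]; rfl⟩
  have hcorner : ((embIter k (transl c ε)) ν : ZMod (P.sitesPerDir 0)) = ((((c ν).val + e) * h + off : ℕ) : ZMod (P.sitesPerDir 0)) := by
    rw [← ZMod.natCast_zmod_val ((embIter k (transl c ε)) ν), hoff]
    have htv : ((transl c ε) ν).val = ((c ν).val + e) % P.sitesPerDir k := by
      rw [transl_apply, heε, ZMod.val_add]
      congr 2
      push_cast
      exact ZMod.val_natCast_of_lt (by omega)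
    rw [htv]
    have hmod : ((c ν).val + e) % P.sitesPerDir k * h = (((c ν).val + e) * h) % P.sitesPerDir 0 := by rw [hNN, Nat.mul_mod_mul_right]
    rw [hmod, Nat.cast_add, ZMod.natCast_mod]
    push_cast
    ring
  -- `z_ν = z′_ν + off = h·c_ν + r + off`
  have hz : (z ν : ZMod (P.sitesPerDir 0)) = (((h * (c ν).val + r : ℕ)) : ZMod (P.sitesPerDir 0)) + (off : ZMod (P.sitesPerDir 0)) := by
    rw [← hdm, ZMod.natCast_zmod_val, hz', transl_apply]; push_cast; ring
  rw [rel_apply]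
  apply (ZMod.valMinAbs_spec _ _).mpr
  refine ⟨?_, ?_⟩
  · rw [hz, hcorner, heε]; push_cast; ring
  · have hN3 : 3 * h ≤ P.sitesPerDir 0 := by rw [hNN]; exact Nat.mul_le_mul_right _ hN
    have hpos' : (0 : ℤ) < h := by exact_mod_cast hpos
    have hr0 : (0 : ℤ) ≤ (r : ℤ) := by positivity
    have hr1 : (r : ℤ) + 1 ≤ (h : ℤ) := by exact_mod_cast hrlt
    have hN3' : 3 * (h : ℤ) ≤ (P.sitesPerDir 0 : ℤ) := by exact_mod_cast hN3
    rcases he01 with h0 | h1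
    · subst h0; rw [heε]; simp only [Nat.cast_zero, zero_mul, sub_zero, Set.mem_Ioc]; constructor <;> linarith
    · subst h1; rw [heε]; simp only [Nat.cast_one, one_mul, Set.mem_Ioc]; constructor <;> linarith

/-- Each relative coordinate of a site from a corner of its cell is at most `L^k` in absolute value. [cite: Balaban1984PropagatorsI, (1.6) p.18] -/
theorem natAbs_rel_corner_le (hk : k ≤ P.m + P.K) (hN : 3 ≤ P.sitesPerDir k) {off : ℕ}
    (hoff : ∀ (y : Site P k) (μ : Fin P.d), ((embIter k y) μ).val = (y μ).val * P.L ^ k + off)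
    (z : Site P 0) (ε : LSite P.d) (hε : ∀ ν, ε ν = 0 ∨ ε ν = 1) (ν : Fin P.d) :
    (rel (embIter k (transl (iterBlockOf k (transl z (fun _ => -(off : ℤ)))) ε)) z ν).natAbs ≤ P.L ^ k := by
  rw [rel_corner_eq hk hN hoff z ε hε ν]
  have hrlt : ((transl z (fun _ => -(off : ℤ))) ν).val % P.L ^ k < P.L ^ k := Nat.mod_lt _ (pow_pos P.L_pos k)
  generalize ((transl z (fun _ => -(off : ℤ))) ν).val % P.L ^ k = r at hrlt
  rcases hε ν with h0 | h1
  · rw [h0]; omega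
  · rw [h1]; omega

/-- Hence the comb from a corner of the cell of `z` to `z` has at most `d·L^k` bonds. [cite: Balaban1984PropagatorsI, (1.7) p.18] -/
theorem l1_rel_corner_le (hk : k ≤ P.m + P.K) (hN : 3 ≤ P.sitesPerDir k) {off : ℕ}
    (hoff : ∀ (y : Site P k) (μ : Fin P.d), ((embIter k y) μ).val = (y μ).val * P.L ^ k + off)
    (z : Site P 0) (ε : LSite P.d) (hε : ∀ ν, ε ν = 0 ∨ ε ν = 1) :
    l1 (rel (embIter k (transl (iterBlockOf k (transl z (fun _ => -(off : ℤ)))) ε)) z) ≤ P.d * P.L ^ k := by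
  unfold l1
  calc ∑ ν, (rel (embIter k (transl (iterBlockOf k (transl z (fun _ => -(off : ℤ)))) ε)) z ν).natAbs ≤ ∑ _ν : Fin P.d, P.L ^ k :=
        Finset.sum_le_sum fun ν _ => natAbs_rel_corner_le hk hN hoff z ε hε ν
    _ = P.d * P.L ^ k := by simp

/-- No wrap-around of a bond seen from a corner of the cell: `2·(rel_μ + 1) ≤ N₀`. [cite: Balaban1987RG1, (0.1) p.252] -/
theorem noWrap_corner (hk : k ≤ P.m + P.K) (hN : 3 ≤ P.sitesPerDir k) {off : ℕ}
    (hoff : ∀ (y : Site P k) (μ : Fin P.d), ((embIter k y) μ).val = (y μ).val * P.L ^ k + off)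
    (z : Site P 0) (ε : LSite P.d) (hε : ∀ ν, ε ν = 0 ∨ ε ν = 1) (μ : Fin P.d) :
    (rel (embIter k (transl (iterBlockOf k (transl z (fun _ => -(off : ℤ)))) ε)) z μ + 1) * 2 ≤ (P.sitesPerDir 0 : ℤ) := by
  rw [rel_corner_eq hk hN hoff z ε hε μ]
  have hNN : P.sitesPerDir 0 = P.sitesPerDir k * P.L ^ k := sitesPerDir_zero_eq_mul_pow hk
  have hN3 : 3 * P.L ^ k ≤ P.sitesPerDir 0 := by rw [hNN]; exact Nat.mul_le_mul_right _ hN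
  have hrlt : ((transl z (fun _ => -(off : ℤ))) μ).val % P.L ^ k < P.L ^ k := Nat.mod_lt _ (pow_pos P.L_pos k)
  generalize ((transl z (fun _ => -(off : ℤ))) μ).val % P.L ^ k = r at hrlt
  have h1 : (r : ℤ) + 1 ≤ ((P.L ^ k : ℕ) : ℤ) := by exact_mod_cast hrlt
  have h2 : 3 * ((P.L ^ k : ℕ) : ℤ) ≤ (P.sitesPerDir 0 : ℤ) := by exact_mod_cast hN3
  rcases hε μ with h0 | h1'
  · rw [h0]; linarith
  · rw [h1']; linarith

/-- The label of `z − off` does not end at `N₀ − 1` unless `z` is on the far layer of its cell (`r_μ = L^k − 1`). [cite: Balaban1987RG1, (0.1) p.252] -/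
theorem val_add_one_lt_of_mod_ne (hk : k ≤ P.m + P.K) (w : Site P 0) (μ : Fin P.d) (hne : (w μ).val % P.L ^ k ≠ P.L ^ k - 1) :
    (w μ).val + 1 < P.sitesPerDir 0 := by
  have hN : P.sitesPerDir 0 = P.sitesPerDir k * P.L ^ k := sitesPerDir_zero_eq_mul_pow hk
  have hpos : 0 < P.L ^ k := pow_pos P.L_pos k
  have hNk : 1 ≤ P.sitesPerDir k := (P.one_lt_sitesPerDir k).le
  have hlt : (w μ).val < P.sitesPerDir 0 := ZMod.val_lt _
  by_contra hc
  have heq : (w μ).val = P.sitesPerDir k * P.L ^ k - 1 := by rw [← hN]; omega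
  apply hne
  rw [heq]
  have hsplit : P.sitesPerDir k * P.L ^ k - 1 = (P.L ^ k - 1) + P.L ^ k * (P.sitesPerDir k - 1) := by
    have h1 : P.sitesPerDir k * P.L ^ k = P.L ^ k + P.L ^ k * (P.sitesPerDir k - 1) := by
      calc P.sitesPerDir k * P.L ^ k = (1 + (P.sitesPerDir k - 1)) * P.L ^ k := by rw [Nat.add_sub_cancel' hNk]
        _ = P.L ^ k + P.L ^ k * (P.sitesPerDir k - 1) := by ring
    omega
  rw [hsplit, Nat.add_mul_mod_self_left, Nat.mod_eq_of_lt (by omega)]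

/-- **INTERIOR STEP**: if `r_μ(z) < L^k − 1` then the cell of `z + e_μ` is the cell of `z` and `r_μ` increases by one, the other `r_ν` unchanged.
[cite: Balaban1987RG1, (0.1) p.252] -/
theorem cell_shift_of_lt (hk : k ≤ P.m + P.K) {off : ℕ} (z : Site P 0) (μ : Fin P.d)
    (hlt : ((transl z (fun _ => -(off : ℤ))) μ).val % P.L ^ k < P.L ^ k - 1) :
    iterBlockOf k (transl (z.shift μ) (fun _ => -(off : ℤ))) = iterBlockOf k (transl z (fun _ => -(off : ℤ))) ∧
    ((transl (z.shift μ) (fun _ => -(off : ℤ))) μ).val % P.L ^ k = ((transl z (fun _ => -(off : ℤ))) μ).val % P.L ^ k + 1 ∧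
    ∀ ν, ν ≠ μ → ((transl (z.shift μ) (fun _ => -(off : ℤ))) ν).val % P.L ^ k = ((transl z (fun _ => -(off : ℤ))) ν).val % P.L ^ k := by
  rw [transl_neg_shift]
  set w : Site P 0 := transl z (fun _ => -(off : ℤ)) with hw
  have hpos : 0 < P.L ^ k := pow_pos P.L_pos k
  have hne : (w μ).val % P.L ^ k ≠ P.L ^ k - 1 := by omega
  refine ⟨iterBlockOf_shift_of_not_face hk w μ hne, ?_, fun ν hν => ?_⟩
  · have hx1 := val_add_one_lt_of_mod_ne hk w μ hne
    have hsh : ((w.shift μ) μ).val = (w μ).val + 1 := by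
      simp only [Site.shift, Function.update_self]
      rw [ZMod.val_add, ZMod.val_one, Nat.mod_eq_of_lt hx1]
    rw [hsh]
    have hn1 : 1 < P.L ^ k := Nat.sub_pos_iff_lt.mp (Nat.lt_of_le_of_lt (Nat.zero_le _) hlt)
    have hlt' : (w μ).val % P.L ^ k + 1 < P.L ^ k := (Nat.le_sub_one_iff_lt hpos).mp (Nat.succ_le_of_lt hlt)
    rw [Nat.add_mod, Nat.one_mod_eq_one.mpr (by omega), Nat.mod_eq_of_lt hlt']
  · have : (w.shift μ) ν = w ν := by simp only [Site.shift]; rw [Function.update_of_ne hν]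
    rw [this]

/-- **FACE STEP**: if `r_μ(z) = L^k − 1` then the cell of `z + e_μ` is the `μ`-shifted cell and `r_μ(z + e_μ) = 0`, the other `r_ν` unchanged.
[cite: Balaban1987RG1, (0.1) p.252] -/
theorem cell_shift_of_eq (hk : k ≤ P.m + P.K) {off : ℕ} (z : Site P 0) (μ : Fin P.d)
    (heq : ((transl z (fun _ => -(off : ℤ))) μ).val % P.L ^ k = P.L ^ k - 1) :
    iterBlockOf k (transl (z.shift μ) (fun _ => -(off : ℤ))) = (iterBlockOf k (transl z (fun _ => -(off : ℤ)))).shift μ ∧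
    ((transl (z.shift μ) (fun _ => -(off : ℤ))) μ).val % P.L ^ k = 0 ∧
    ∀ ν, ν ≠ μ → ((transl (z.shift μ) (fun _ => -(off : ℤ))) ν).val % P.L ^ k = ((transl z (fun _ => -(off : ℤ))) ν).val % P.L ^ k := by
  rw [transl_neg_shift]
  set w : Site P 0 := transl z (fun _ => -(off : ℤ)) with hw
  refine ⟨iterBlockOf_shift_of_face hk w μ heq, val_shift_mod_of_face hk w μ heq, fun ν hν => ?_⟩
  have : (w.shift μ) ν = w ν := by simp only [Site.shift]; rw [Function.update_of_ne hν]
  rw [this]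

/-- **A CENTRE IS THE CORNER `ε = 0` OF ITS OWN CELL, WITH `r = 0`**: for `z = embIter k c₀`, `iterBlockOf k (z − off) = c₀` and every `r_ν = 0`.
[cite: Balaban1987RG1, (0.1) p.252] -/
theorem cell_centre (hk : k ≤ P.m + P.K) {off : ℕ}
    (hoff : ∀ (y : Site P k) (μ : Fin P.d), ((embIter k y) μ).val = (y μ).val * P.L ^ k + off) (c₀ : Site P k) :
    iterBlockOf k (transl (embIter k c₀) (fun _ => -(off : ℤ))) = c₀ ∧
    ∀ ν, ((transl (embIter k c₀) (fun _ => -(off : ℤ))) ν).val % P.L ^ k = 0 := by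
  have hN : P.sitesPerDir 0 = P.sitesPerDir k * P.L ^ k := sitesPerDir_zero_eq_mul_pow hk
  have hval : ∀ ν, ((transl (embIter k c₀) (fun _ => -(off : ℤ))) ν).val = (c₀ ν).val * P.L ^ k := by
    intro ν
    have hlt : (c₀ ν).val * P.L ^ k < P.sitesPerDir 0 := by
      rw [hN]; exact Nat.mul_lt_mul_of_pos_right (ZMod.val_lt _) (pow_pos P.L_pos k)
    have he : (transl (embIter k c₀) (fun _ => -(off : ℤ))) ν = (((c₀ ν).val * P.L ^ k : ℕ) : ZMod (P.sitesPerDir 0)) := by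
      rw [transl_apply, ← ZMod.natCast_zmod_val ((embIter k c₀) ν), hoff]
      push_cast; ring
    rw [he, ZMod.val_natCast_of_lt hlt]
  refine ⟨?_, fun ν => by rw [hval ν, Nat.mul_mod_left]⟩
  funext ν
  apply ZMod.val_injective
  rw [val_iterBlockOf k hk, hval ν, Nat.mul_div_cancel _ (pow_pos P.L_pos k)]

end Cells

/-! ## §2 The word `Γ_{y,z} ∪ (−Γ_{y′,z})` between two centres through `z` -/

section Words

variable {P : Params} {j : ℕ} {G : Type*} [GaugeGroup G]

omit [GaugeGroup G] in
/-- Net displacement of `Γ_{y,z} ∪ (−Γ_{y′,z})`: `(z − y) − (z − y′)`. [cite: Balaban1984PropagatorsI, (1.7) p.18] -/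
theorem netDisp_cornerWord (y y' z : Site P j) (κ : Fin P.d) :
    netDisp (treeWord (rel y z) ++ wordRev (treeWord (rel y' z))) κ = rel y z κ - rel y' z κ := by
  rw [netDisp_append, netDisp_wordRev, netDisp_treeWord, netDisp_treeWord]; ring

omit [GaugeGroup G] in
/-- `Γ_{y,z} ∪ (−Γ_{y′,z})` walked from `y` ends at `y′`. [cite: Balaban1984PropagatorsI, (1.7) p.18] -/
theorem walkEnd_cornerWord (y y' z : Site P j) : walkEnd y (treeWord (rel y z) ++ wordRev (treeWord (rel y' z))) = y' := by
  rw [walkEnd_append, walkEnd_treeWord_rel]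
  have h := walkEnd_walkEnd_wordRev y' (treeWord (rel y' z))
  rwa [walkEnd_treeWord_rel] at h

omit [GaugeGroup G] in
/-- Its length is `|z − y|₁ + |z − y′|₁`. [cite: Balaban1984PropagatorsI, (1.7) p.18] -/
theorem length_cornerWord (y y' z : Site P j) :
    (treeWord (rel y z) ++ wordRev (treeWord (rel y' z))).length = l1 (rel y z) + l1 (rel y' z) := by
  simp only [List.length_append, wordRev, List.length_reverse, List.length_map, B7Prop1Explicit.length_treeWord]

/-- **`U(Γ_{y,z})·U(Γ_{y′,z})⁻¹` IS THE HOLONOMY OF `Γ_{y,z} ∪ (−Γ_{y′,z})`.** [cite: Balaban1985Averaging, (7)-(9) pp.18-19] -/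
theorem axialT_mul_inv_eq_holAt (U : GaugeField P j G) (y y' z : Site P j) :
    axialT U y z * (axialT U y' z)⁻¹ = holAt U (walk y (treeWord (rel y z) ++ wordRev (treeWord (rel y' z)))) := by
  rw [walk_append, holAt_append, walkEnd_treeWord_rel]
  have h := holAt_walk_wordRev U y' (treeWord (rel y' z))
  rw [walkEnd_treeWord_rel] at h
  rw [h, ← holT_eq_holAt, ← holT_eq_holAt]
  rfl

end Words

/-! ## §3 (E1) The explicit comb element from an arbitrary centre and its transport along a bond -/

section Transport

variable {P : Params} {j : ℕ} {G : Type*} [GaugeGroup G]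

/-- **THE COMB ELEMENT `v_y(x) = U₀(Γ_{y,x})⁻¹·W(Γ_{y,x})` GAUGES `W` AXIALLY FROM `y` AT EVERY SITE** (the computation of gen 7's
`Prop7AxialGauge.exists_axialGauge`, for one fixed centre `y`). [cite: Balaban1985Variational, (18) p.280; Balaban1985RegularSpaces, (1.19) p.79] -/
theorem axialT_combElem (W U₀ : GaugeField P j G) (y x : Site P j) :
    axialT (gaugeActT (fun x' => (axialT U₀ y x')⁻¹ * axialT W y x') W) y x = axialT U₀ y x := by
  rw [axialT_gaugeActT]
  simp only [axialT_self, inv_one, one_mul, mul_inv_rev, inv_inv, mul_inv_cancel_left]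

/-- **(E1) TRANSPORT OF THE COMB ELEMENT ALONG A BOND**: plaquette variables of `W`, `U₀` within `δ_W, δ₀ ≥ 0` of `1`, the bond `⟨x, μ⟩` not wrapping
relative to `y` ⟹ `dist1(v_y(x)·W_b·v_y(x + e_μ)⁻¹·U₀,b⁻¹) ≤ |x − y|₁·(δ_W + δ₀)` — i.e. `v_y(x + e_μ) = U₀,b⁻¹·r⁻¹·v_y(x)·W_b` with `dist1(r) ≤ |x − y|₁(δ_W + δ₀)`
([Balaban1985RegularSpaces] Lemma 1's interior mechanism, gen 7 `Prop7AxialGaugeSup.dist1_mul_inv_le_of_axial`, for a comb of any length).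
[cite: Balaban1985RegularSpaces, Lemma 1 (1.25) p.79; Balaban1985Averaging, (8) p.18 and pp.24-25] -/
theorem dist1_combElem_transport_le (W U₀ : GaugeField P j G) {δW δ₀ : ℝ} (hδW : 0 ≤ δW) (hδ₀ : 0 ≤ δ₀)
    (hW : PlaqSmall δW W) (hU₀ : PlaqSmall δ₀ U₀) (y x : Site P j) (μ : Fin P.d) (hwrap : (rel y x μ + 1) * 2 ≤ (P.sitesPerDir j : ℤ)) :
    dist1 (((axialT U₀ y x)⁻¹ * axialT W y x) * W ⟨x, μ⟩ * ((axialT U₀ y (x.shift μ))⁻¹ * axialT W y (x.shift μ))⁻¹ * (U₀ ⟨x, μ⟩)⁻¹) ≤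
      (l1 (rel y x) : ℝ) * (δW + δ₀) := by
  set v : GaugeTransf P j G := fun x' => (axialT U₀ y x')⁻¹ * axialT W y x' with hv
  have hWv : PlaqSmall δW (gaugeActT v W) := (T3PrintedRegularOrbits.plaqSmall_gaugeAct_iff' δW v W).mpr hW
  have h := dist1_mul_inv_le_of_axial (gaugeActT v W) U₀ hδW hδ₀ hWv hU₀ y x μ hwrap (axialT_combElem W U₀ y x)
    (axialT_combElem W U₀ y (x.shift μ))
  have e : gaugeActT v W ⟨x, μ⟩ = v x * W ⟨x, μ⟩ * (v (x.shift μ))⁻¹ := rfl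
  rwa [e] at h

end Transport

/-! ## §4 (E2) At the d = 3 carrier: comb elements of one regular (0.4)-fibre from adjacent centres are `O(ε₀ + e₀)`-close -/

section T3

open Literature.MathematicalPhysics.QuantumFieldTheory.Balaban1983to89.T3ContinuumYM3Torus
open Literature.MathematicalPhysics.QuantumFieldTheory.Balaban1983to89.T3RegularMinimiser (regThreshold)
open Literature.MathematicalPhysics.QuantumFieldTheory.Balaban1983to89.T3PrintedRegularMinimiser (RegPr RegPr.plaqSmall)
open Summit.QuantumFields.YangMills.Theorems.IterPlaqSmall (dist1_contour_iter_le_T3)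

variable (F : T3Family) (n K : ℕ)

/-- The ★19200-p2 transport comparison on the word `Γ_{y,z} ∪ (−Γ_{y′,z})` between ADJACENT `(K−n)`-fold centres `y = embIter c₁`,
`y′ = embIter (c₁ + e_ν)` through a site `z` with both combs of length `≤ 3L^{K−n}`: the `(K−n)`-fold (0.4)-average of a regular `U` at the coarse bond
`⟨c₁, ν⟩` is within `(100L^{2k} + (7L^k)²/4)·e·L^{−2k} = 112.25e` of `U(Γ_{y,z})U(Γ_{y′,z})⁻¹`. [cite: Balaban1985Variational, (145) and (151) p.301] -/
theorem dist1_iter_mul_inv_cornerWord_le_T3 (hL : 7 ≤ F.L) {e : ℝ} (he : 0 < e) (hε : 50 * (500 * (F.L : ℝ) + 7 * (F.L : ℝ) ^ 2) * e ≤ 1)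
    (U : GaugeField (F.P K) 0 (Matrix.specialUnitaryGroup (Fin 2) ℂ)) (hU : RegPr F n K e U)
    (c₁ : Site (F.P K) (K - n)) (ν : Fin (F.P K).d) (z : Site (F.P K) 0)
    (hrel : ∀ κ, rel (embIter (K - n) c₁) z κ - rel (embIter (K - n) (c₁.shift ν)) z κ =
      if ν = κ then (((F.L ^ (K - n) : ℕ)) : ℤ) else 0)
    (hl : l1 (rel (embIter (K - n) c₁) z) ≤ 3 * F.L ^ (K - n)) (hl' : l1 (rel (embIter (K - n) (c₁.shift ν)) z) ≤ 3 * F.L ^ (K - n)) :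
    dist1 (Averaging.iter (fun j => blockAvg (P := F.P K) (j := j) (ExpMeanLog.expMeanLogSU (n := Fin 2))) (K - n) U ⟨c₁, ν⟩ *
        (axialT U (embIter (K - n) c₁) z * (axialT U (embIter (K - n) (c₁.shift ν)) z)⁻¹)⁻¹) ≤ (449 / 4) * e := by
  have hclosed : ∀ κ, netDisp ([] : List (Letter (F.P K).d)) κ +
      (if (⟨c₁, ν⟩ : PBond (F.P K) (K - n)).dir = κ then ((((F.P K).L ^ (K - n) : ℕ) : ℤ)) else 0) -
      netDisp (treeWord (rel (embIter (K - n) c₁) z) ++ wordRev (treeWord (rel (embIter (K - n) (c₁.shift ν)) z))) κ = 0 := by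
    intro κ
    rw [netDisp_cornerWord, hrel κ]
    simp
  have H := dist1_contour_iter_le_T3 F n K hL he hε embIter (fun _ => rfl) (fun _ _ => rfl) U (RegPr.plaqSmall hU) (le_refl (K - n))
    ⟨c₁, ν⟩ (embIter (K - n) c₁) [] _ rfl (walkEnd_cornerWord _ _ _) hclosed
  simp only [walk, holAt_nil, one_mul, List.length_nil, Nat.cast_zero, zero_add] at H
  rw [axialT_mul_inv_eq_holAt]
  refine H.trans ?_
  -- arithmetic: `len ≤ 6L^k`, `(100L^{2k} + (7L^k)²/4)·e·L^{−2k} = 449e/4`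
  have hlen : ((treeWord (rel (embIter (K - n) c₁) z) ++ wordRev (treeWord (rel (embIter (K - n) (c₁.shift ν)) z))).length : ℝ) ≤
      6 * (F.L : ℝ) ^ (K - n) := by
    rw [length_cornerWord]
    have : l1 (rel (embIter (K - n) c₁) z) + l1 (rel (embIter (K - n) (c₁.shift ν)) z) ≤ 6 * F.L ^ (K - n) := by omega
    exact_mod_cast this
  have hL0 : (0 : ℝ) < (F.L : ℝ) := by exact_mod_cast (show 0 < F.L by omega)
  have hreg : regThreshold F n K e = e * ((F.L : ℝ)⁻¹) ^ (2 * (K - n)) := rfl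
  have hcancel : (F.L : ℝ) ^ (2 * (K - n)) * (((F.L : ℝ))⁻¹) ^ (2 * (K - n)) = 1 := by
    rw [← mul_pow, mul_inv_cancel₀ hL0.ne', one_pow]
  have h0 : (0 : ℝ) ≤ (F.L : ℝ) ^ (K - n) + ((treeWord (rel (embIter (K - n) c₁) z) ++
      wordRev (treeWord (rel (embIter (K - n) (c₁.shift ν)) z))).length : ℝ) := by positivity
  have h7 : (F.L : ℝ) ^ (K - n) + ((treeWord (rel (embIter (K - n) c₁) z) ++
      wordRev (treeWord (rel (embIter (K - n) (c₁.shift ν)) z))).length : ℝ) ≤ 7 * (F.L : ℝ) ^ (K - n) := by linarith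
  have hsq := pow_le_pow_left₀ h0 h7 2
  have hreg0 : 0 ≤ regThreshold F n K e := by rw [hreg]; positivity
  calc (100 * (F.L : ℝ) ^ (2 * (K - n)) + ((F.L : ℝ) ^ (K - n) + ((treeWord (rel (embIter (K - n) c₁) z) ++
          wordRev (treeWord (rel (embIter (K - n) (c₁.shift ν)) z))).length : ℝ)) ^ 2 / 4) * regThreshold F n K e
      ≤ (100 * (F.L : ℝ) ^ (2 * (K - n)) + (7 * (F.L : ℝ) ^ (K - n)) ^ 2 / 4) * regThreshold F n K e := by
        apply mul_le_mul_of_nonneg_right _ hreg0; linarith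
    _ = (449 / 4) * e := by
        have h7' : (7 * (F.L : ℝ) ^ (K - n)) ^ 2 = 49 * (F.L : ℝ) ^ (2 * (K - n)) := by rw [mul_pow, ← pow_mul, mul_comm (K - n) 2]; norm_num
        rw [h7', hreg]
        linear_combination (449 / 4) * e * hcancel

/-- **(E2) THE COCYCLE OF COMB GAUGES IS SMALL**: `W ∈ 𝔘_k(e_W)`, `U₀ ∈ 𝔘_k(e₀)` (plaquette clause of (2)) with the SAME `(K−n)`-fold
(0.4)-average (e.g. one (0.4)-fibre), `L ≥ 7`, `50(500L + 7L²)e ≤ 1` for both radii; `y = embIter c₁`, `y′ = embIter (c₁ + e_ν)` adjacent centres whose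
combs to `z` have length `≤ 3L^{K−n}` and net difference `L^{K−n}e_ν` (the corners of a cell, §1) ⟹ the two comb elements at `z` satisfy
`dist1(v_y(z)·v_{y′}(z)⁻¹) ≤ (449/4)·(e_W + e₀)` — uniformly in `K − n` and in the volume. [cite: Balaban1985RegularSpaces, Lemma 1 (1.25)-(1.26) p.79; Balaban1985Variational, (145)/(151) p.301] -/
theorem dist1_combElem_mul_inv_le_T3 (hL : 7 ≤ F.L) {eW e₀ : ℝ} (heW : 0 < eW) (he₀ : 0 < e₀)
    (hεW : 50 * (500 * (F.L : ℝ) + 7 * (F.L : ℝ) ^ 2) * eW ≤ 1) (hε₀ : 50 * (500 * (F.L : ℝ) + 7 * (F.L : ℝ) ^ 2) * e₀ ≤ 1)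
    (W U₀ : GaugeField (F.P K) 0 (Matrix.specialUnitaryGroup (Fin 2) ℂ)) (hW : RegPr F n K eW W) (hU₀ : RegPr F n K e₀ U₀)
    (hdesc : Averaging.iter (fun j => blockAvg (P := F.P K) (j := j) (ExpMeanLog.expMeanLogSU (n := Fin 2))) (K - n) W =
      Averaging.iter (fun j => blockAvg (P := F.P K) (j := j) (ExpMeanLog.expMeanLogSU (n := Fin 2))) (K - n) U₀)
    (c₁ : Site (F.P K) (K - n)) (ν : Fin (F.P K).d) (z : Site (F.P K) 0)
    (hrel : ∀ κ, rel (embIter (K - n) c₁) z κ - rel (embIter (K - n) (c₁.shift ν)) z κ =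
      if ν = κ then (((F.L ^ (K - n) : ℕ)) : ℤ) else 0)
    (hl : l1 (rel (embIter (K - n) c₁) z) ≤ 3 * F.L ^ (K - n)) (hl' : l1 (rel (embIter (K - n) (c₁.shift ν)) z) ≤ 3 * F.L ^ (K - n)) :
    dist1 (((axialT U₀ (embIter (K - n) c₁) z)⁻¹ * axialT W (embIter (K - n) c₁) z) *
        ((axialT U₀ (embIter (K - n) (c₁.shift ν)) z)⁻¹ * axialT W (embIter (K - n) (c₁.shift ν)) z)⁻¹) ≤ (449 / 4) * (eW + e₀) := by
  set A₀ := axialT U₀ (embIter (K - n) c₁) z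
  set A := axialT W (embIter (K - n) c₁) z
  set A₀' := axialT U₀ (embIter (K - n) (c₁.shift ν)) z
  set A' := axialT W (embIter (K - n) (c₁.shift ν)) z
  set V := Averaging.iter (fun j => blockAvg (P := F.P K) (j := j) (ExpMeanLog.expMeanLogSU (n := Fin 2))) (K - n) U₀ ⟨c₁, ν⟩ with hV
  have hconj : (A₀⁻¹ * A) * (A₀'⁻¹ * A')⁻¹ = A₀⁻¹ * ((A * A'⁻¹) * (A₀ * A₀'⁻¹)⁻¹) * A₀⁻¹⁻¹ := by group
  rw [hconj, GaugeGroup.dist1_conj]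
  have hW' := dist1_iter_mul_inv_cornerWord_le_T3 F n K hL heW hεW W hW c₁ ν z hrel hl hl'
  have hU' := dist1_iter_mul_inv_cornerWord_le_T3 F n K hL he₀ hε₀ U₀ hU₀ c₁ ν z hrel hl hl'
  rw [hdesc] at hW'
  have hkey : (A * A'⁻¹) * (A₀ * A₀'⁻¹)⁻¹ = (V * (A * A'⁻¹)⁻¹)⁻¹ * (V * (A₀ * A₀'⁻¹)⁻¹) := by group
  rw [hkey]
  calc dist1 ((V * (A * A'⁻¹)⁻¹)⁻¹ * (V * (A₀ * A₀'⁻¹)⁻¹))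
      ≤ dist1 ((V * (A * A'⁻¹)⁻¹)⁻¹) + dist1 (V * (A₀ * A₀'⁻¹)⁻¹) := GaugeGroup.dist1_mul_le _ _
    _ = dist1 (V * (A * A'⁻¹)⁻¹) + dist1 (V * (A₀ * A₀'⁻¹)⁻¹) := by rw [GaugeGroup.dist1_inv]
    _ ≤ (449 / 4) * eW + (449 / 4) * e₀ := add_le_add hW' hU'
    _ = (449 / 4) * (eW + e₀) := by ring

end T3

end Summit.QuantumFields.YangMills.Theorems.Prop7BlendCells

end
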